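import Summits.AtomisticToContinuum.Crystallization.Theses.NashClassCertificates
import Summits.AtomisticToContinuum.Crystallization.Theorems.LayeredLawsSelectHcp.Negative.FccLattice
import Summits.AtomisticToContinuum.Crystallization.Theorems.PhononSlackCertificatesNearFarGlueRLatticeShell

/-!
# On-lattice occupied two-shell environments are exactly matched (crux `NashTwoShellGap`,
# stmt-AtomisticToContinuum-16826, line `bulk_dilute`, stub `stub_fccOccupiedGood`)

STATEMENT. Let `x : Fin N → ℝ³` be an injective configuration supported on the fcc lattice
`fccD3 a = (a/√2)·D₃` (nearest-neighbour distance `a ∈ [47/50, 1]`). If all `18` two-shell lattice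
sites `x i + a • v`, `v ∈ fccTwoShellPattern` (`12` at distance `a`, `6` at distance `√2·a`), of a
particle `i` are occupied, then `i` is `1/20`-good in the sense of `IsTwoShellGood (1/20) (47/50) 1`
— indeed its `3a/2`-neighbourhood is EXACTLY the scaled pattern (identity isometry, tolerance unused).

PROOF. This is the tree's `PhononSlackCertificatesNearFarGlueR.good_of_sites_occupied` (crux
`NearFarGlueR`, stmt-AtomisticToContinuum-14970: exact match at scale `a`, `A = id`,
`P = fccTwoShellPattern`, `f v :=` the occupant of the site `x i + a • v`; the two-way clause by the
`3/2`-shell lemma `twoShell_fccD3`), whose occupancy hypothesis is phrased over the integer model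
`fccInt ∪ fccSecondShellInt` with sites `x i + cs a • intVec v`; the pattern point `v/√2` of
`fccTwoShellPattern = scaledPattern (fccInt ∪ fccSecondShellInt) 2` has `a • (v/√2) = cs a • intVec v`
(`smul_patternPt`), so the present (pattern-phrased) occupancy hypothesis supplies it.
-/

noncomputable section

namespace Summit.AtomisticToContinuum.Crystallization.Theorems.NashTwoShellGapFccOccupiedGood

open Literature.Geometry.DiscreteGeometry
open Summit.AtomisticToContinuum.Crystallization.Theorems.LayeredLawsSelectHcp.Negative.FccLattice
open Summit.AtomisticToContinuum.Crystallization.Theorems.PhononSlackCertificatesNearFarGlueR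
  (good_of_sites_occupied smul_patternPt)

/-- **Stub `stub_fccOccupiedGood` of line `bulk_dilute` (crux `NashTwoShellGap`,
stmt-AtomisticToContinuum-16826)**: on an injective configuration supported on `fccD3 a`
(`47/50 ≤ a ≤ 1`), a particle all of whose `18` two-shell lattice sites `x i + a • v`
(`v ∈ fccTwoShellPattern`) are occupied is `1/20`-good (exactly matched, identity isometry;
`good_of_sites_occupied` with the occupancy hypothesis transported along
`a • (v/√2) = cs a • intVec v`). [folklore] -/
theorem stub_fccOccupiedGood : ∀ (a : ℝ), 47 / 50 ≤ a → a ≤ 1 → ∀ (N : ℕ) (x : Fin N → EuclideanSpace ℝ (Fin 3)), Function.Injective x → (∀ i : Fin N, x i ∈ (Summit.AtomisticToContinuum.Crystallization.Theorems.LayeredLawsSelectHcp.Negative.FccLattice.fccD3 a : Set (EuclideanSpace ℝ (Fin 3)))) → ∀ i : Fin N, (∀ v ∈ Literature.Geometry.DiscreteGeometry.fccTwoShellPattern, ∃ j : Fin N, x j = x i + a • v) → Literature.Geometry.DiscreteGeometry.IsTwoShellGood (1 / 20) (47 / 50) 1 x i := by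
  intro a h47 h1 N x hx hmem i hocc
  refine good_of_sites_occupied h47 h1 hx hmem i fun v hv => ?_
  have hv' : (Real.sqrt (2 : ℕ))⁻¹ • intVec v ∈ fccTwoShellPattern := Finset.mem_image_of_mem _ hv
  obtain ⟨j, hj⟩ := hocc _ hv'
  exact ⟨j, by rw [hj, smul_patternPt]⟩

end Summit.AtomisticToContinuum.Crystallization.Theorems.NashTwoShellGapFccOccupiedGood

end
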